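import Summits.CriticalPhenomena.PercolationContinuityZ3.Theorems.SahiMasterFamilyRigidityR3
import Summits.CriticalPhenomena.PercolationContinuityZ3.Theorems.SahiMasterFamilySharedCoordinate

/-!
# Rigidity at every order, preliminaries: the multi-target identity (GI) in `ℝ[X_ι]`, restriction, substitution homomorphisms

Support file of the master-family programme (crux `NoHeavyLowerTail`, stmt-CriticalPhenomena-4575; cell `prim-masterthm`, seat P4,
unit `prim-masterthm-p4-g8`).  Seat document HOME/prim-masterthm-p4/RIGIDITY-ALLK.md (THEOREM R* — rigidity of the `(k−1)`-shared-coordinate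
detector identity at EVERY order `k`; R₃ is `RigidityR3.rigidity_three`).  First file: infrastructure.

* `GI J V₀ V Q` — the GENERALISED IDENTITY `Σ_{j∈J} μ(V_j ∩ Q_j) Π_{l≠j} μ(Q_l) = μ(V₀) Π_l μ(Q_l)` as an identity of expectation polynomials
  (`exPoly`) in `ℝ[X_ι]` (the cleared form of `Σ_j μ_p(V_j | Q_j) = μ_p(V₀)`, voters `j` indexed by a `Finset`);
* `gi_of_forall_interior` (the identity at every interior `p` gives `GI`), `GI.eval_eq` (and conversely at every real point),
  `GI.restrict` (voters with `V_j ∩ Q_j = ∅` may be deleted);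
* `substAt x c` — the substitution `X_x ↦ c` as an `ℝ`-algebra endomorphism, `substAt_zero_exPoly` / `substAt_one_exPoly`
  (it sends `E(h)` to `E(h^{x←0})` / `E(h^{x←1})`), and `exPoly_ind_eq_X_mul` (an event frozen to `1` at `x` has `E(1_Q) = X_x · E(1_{Q^{x←1}})`).
HONEST FRAMING: infrastructure; Sahi `C_k` / Kahn's Conj. 5 / the master theorem remain OPEN.  [this work]
-/

noncomputable section

open scoped Classical

namespace Summit.CriticalPhenomena.PercolationContinuityZ3.Theorems

open Finset Function MvPolynomial
open Literature.Combinatorics.Sahi2008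
open Literature.Probability.Percolation.BHK2006 (weight)
open Literature.Probability.Percolation.DecisionTree (ind ind_of_mem ind_of_not_mem ind_nonneg)
open SharedCoordinate (Ignores xInd)
open ExpectationRigidity RigidityR3

namespace RigidityAll

variable {ι : Type*} [Fintype ι] {κ : Type*}

/-! ### Indicators and sections -/

omit [Fintype ι] in
/-- `1_{A^{x←b}} = (1_A)^{x←b}`. [this work] -/
theorem ind_secAt (x : ι) (b : Bool) (A : Set (Set ι)) : ind (secAt x b A) = fsec x b (ind A) := by
  funext ω
  have hm : ω ∈ secAt x b A ↔ forceAt x b ω ∈ A := mem_secAt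
  simp only [fsec]
  by_cases hω : forceAt x b ω ∈ A
  · rw [ind_of_mem (hm.2 hω), ind_of_mem hω]
  · rw [ind_of_not_mem fun h => hω (hm.1 h), ind_of_not_mem hω]

omit [Fintype ι] in
/-- The indicator of the empty event. [folklore] -/
theorem ind_empty_eq : ind (∅ : Set (Set ι)) = 0 := by
  funext ω; exact ind_of_not_mem (Set.notMem_empty ω)

omit [Fintype ι] in
/-- Equal indicator values mean equal membership. [folklore] -/
theorem mem_iff_of_ind_eq {A B : Set (Set ι)} {ω ω' : Set ι} (h : ind A ω = ind B ω') : ω ∈ A ↔ ω' ∈ B := by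
  by_cases h1 : ω ∈ A <;> by_cases h2 : ω' ∈ B
  · exact ⟨fun _ => h2, fun _ => h1⟩
  · rw [ind_of_mem h1, ind_of_not_mem h2] at h; exact absurd h one_ne_zero
  · rw [ind_of_not_mem h1, ind_of_mem h2] at h; exact absurd h.symm one_ne_zero
  · exact ⟨fun h' => absurd h' h1, fun h' => absurd h' h2⟩

omit [Fintype ι] in
/-- Events with equal indicators are equal. [folklore] -/
theorem eq_of_ind_eq {A B : Set (Set ι)} (h : ind A = ind B) : A = B :=
  Set.ext fun ω => mem_iff_of_ind_eq (congrFun h ω)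

omit [Fintype ι] in
/-- An `e`-free indicator means an `e`-free event. [this work] -/
theorem forall_iff_of_ignores {y : ι} {A : Set (Set ι)} (h : Ignores y (ind A)) (ω : Set ι) : insert y ω ∈ A ↔ ω ∈ A :=
  mem_iff_of_ind_eq (h ω)

omit [Fintype ι] in
/-- `1_{A ∩ B} = 1_A · 1_B`. [folklore] -/
theorem ind_inter_eq_mul (A B : Set (Set ι)) : ind (A ∩ B) = ind A * ind B := by
  funext ω; exact Literature.Probability.Percolation.BHK2006.ind_inter A B ω

/-- `exPoly 0 = 0`. [this work] -/
theorem exPoly_zero : exPoly (0 : Set ι → ℝ) = 0 := exPoly_eq_zero_iff.2 rfl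

/-- `exPoly` is injective. [this work] -/
theorem exPoly_injective {f g : Set ι → ℝ} (h : exPoly f = exPoly g) : f = g := by
  have : exPoly (f - g) = 0 := by rw [exPoly_sub, h, sub_self]
  exact sub_eq_zero.1 (exPoly_eq_zero_iff.1 this)

/-- **`E(1_{2^ι}) = 1` in `ℝ[X_ι]`** (total mass one as a polynomial identity). [this work] -/
theorem exPoly_ind_univ : exPoly (ind (Set.univ : Set (Set ι))) = 1 := by
  refine mvpoly_eq_of_eval_eq 1 (fun i => degreeOf_exPoly_le _ i) (fun i => by rw [← C_1, degreeOf_C]; exact Nat.zero_le _)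
    fun x hx => ?_
  rw [eval_exPoly, map_one]
  set p : ι → unitInterval := fun i => ⟨x i, (hx i).1.le, (hx i).2.le⟩ with hp
  have hw : weight x = bernoulliWeight p := rfl
  rw [hw, ex, ← sum_bernoulliWeight p]
  exact sum_congr rfl fun ω _ => by rw [ind_of_mem (Set.mem_univ ω), mul_one]

/-! ### The generalised identity (GI) -/

/-- (GI): `Σ_{j∈J} E(1_{V_j ∩ Q_j}) Π_{l∈J∖j} E(1_{Q_l}) = E(1_{V₀}) Π_{l∈J} E(1_{Q_l})` in `ℝ[X_ι]` (cleared form of `Σ_j μ(V_j|Q_j) = μ(V₀)`). [this work] -/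
def GI (J : Finset κ) (V₀ : Set (Set ι)) (V Q : κ → Set (Set ι)) : Prop :=
  ∑ j ∈ J, exPoly (ind (V j ∩ Q j)) * ∏ l ∈ J.erase j, exPoly (ind (Q l)) =
    exPoly (ind V₀) * ∏ l ∈ J, exPoly (ind (Q l))

/-- Degree bound for a product of expectation polynomials. [this work] -/
theorem degreeOf_prod_exPoly_le (i : ι) (T : Finset κ) (f : κ → Set ι → ℝ) :
    degreeOf i (∏ l ∈ T, exPoly (f l)) ≤ T.card := by
  refine (degreeOf_prod_le i _ _).trans ?_
  calc ∑ l ∈ T, (exPoly (f l)).degreeOf i ≤ ∑ _l ∈ T, 1 := sum_le_sum fun l _ => degreeOf_exPoly_le _ i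
    _ = T.card := by simp

/-- **The identity at every interior `p` gives (GI).** [this work] -/
theorem gi_of_forall_interior {J : Finset κ} {V₀ : Set (Set ι)} {V Q : κ → Set (Set ι)}
    (h : ∀ p : ι → unitInterval, (∀ e, (p e : ℝ) ∈ Set.Ioo (0 : ℝ) 1) →
      ∑ j ∈ J, ex (bernoulliWeight p) (ind (V j ∩ Q j)) * ∏ l ∈ J.erase j, ex (bernoulliWeight p) (ind (Q l)) =
        ex (bernoulliWeight p) (ind V₀) * ∏ l ∈ J, ex (bernoulliWeight p) (ind (Q l))) :
    GI J V₀ V Q := by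
  refine mvpoly_eq_of_eval_eq (J.card + 1) (fun i => ?_) (fun i => ?_) fun x hx => ?_
  · refine (degreeOf_sum_le i _ _).trans (Finset.sup_le fun j _ => ?_)
    refine (degreeOf_mul_le i _ _).trans ?_
    have h1 := degreeOf_exPoly_le (ind (V j ∩ Q j)) i
    have h2 := degreeOf_prod_exPoly_le i (J.erase j) (fun l => ind (Q l))
    have h3 : (J.erase j).card ≤ J.card := card_erase_le
    omega
  · refine (degreeOf_mul_le i _ _).trans ?_
    have h1 := degreeOf_exPoly_le (ind V₀) i
    have h2 := degreeOf_prod_exPoly_le i J (fun l => ind (Q l))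
    omega
  · simp only [map_sum, map_mul, map_prod, eval_exPoly]
    exact h (fun i => ⟨x i, (hx i).1.le, (hx i).2.le⟩) hx

/-- **(GI) evaluated at a real point.** [this work] -/
theorem GI.eval_eq {J : Finset κ} {V₀ : Set (Set ι)} {V Q : κ → Set (Set ι)} (h : GI J V₀ V Q) (x : ι → ℝ) :
    ∑ j ∈ J, ex (weight x) (ind (V j ∩ Q j)) * ∏ l ∈ J.erase j, ex (weight x) (ind (Q l)) =
      ex (weight x) (ind V₀) * ∏ l ∈ J, ex (weight x) (ind (Q l)) := by
  have := congrArg (MvPolynomial.eval x) h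
  simpa only [map_sum, map_mul, map_prod, eval_exPoly] using this

/-- A product of expectation polynomials of nonempty events is nonzero. [this work] -/
theorem prod_exPoly_ind_ne_zero {T : Finset κ} {Q : κ → Set (Set ι)} (hne : ∀ l ∈ T, (Q l).Nonempty) :
    ∏ l ∈ T, exPoly (ind (Q l)) ≠ 0 :=
  prod_ne_zero_iff.2 fun l hl => exPoly_ind_ne_zero (hne l hl)

/-- **Restriction: voters with `V_j ∩ Q_j = ∅` may be deleted from (GI).** [this work] -/
theorem GI.restrict {J J' : Finset κ} {V₀ : Set (Set ι)} {V Q : κ → Set (Set ι)} (h : GI J V₀ V Q) (hJ' : J' ⊆ J)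
    (hne : ∀ l ∈ J, (Q l).Nonempty) (hz : ∀ j ∈ J, j ∉ J' → V j ∩ Q j = ∅) : GI J' V₀ V Q := by
  unfold GI at h ⊢
  set D : κ → MvPolynomial ι ℝ := fun l => exPoly (ind (Q l)) with hD
  set R := ∏ l ∈ J \ J', D l with hR
  have hRne : R ≠ 0 := prod_exPoly_ind_ne_zero fun l hl => hne l (mem_sdiff.1 hl).1
  have hdisj : ∀ j, Disjoint (J'.erase j) (J \ J') := fun j =>
    disjoint_left.2 fun l hl hl' => (mem_sdiff.1 hl').2 (mem_of_mem_erase hl)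
  have hsplit : ∀ j ∈ J', ∏ l ∈ J.erase j, D l = (∏ l ∈ J'.erase j, D l) * R := by
    intro j hj
    have hset : J.erase j = J'.erase j ∪ (J \ J') := by
      ext l
      simp only [mem_erase, mem_union, mem_sdiff]
      constructor
      · rintro ⟨hlj, hlJ⟩
        by_cases hl' : l ∈ J'
        · exact Or.inl ⟨hlj, hl'⟩
        · exact Or.inr ⟨hlJ, hl'⟩
      · rintro (⟨hlj, hl'⟩ | ⟨hlJ, hl'⟩)
        · exact ⟨hlj, hJ' hl'⟩
        · exact ⟨fun h => hl' (h ▸ hj), hlJ⟩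
    rw [hset, prod_union (hdisj j)]
  have hfull : ∏ l ∈ J, D l = (∏ l ∈ J', D l) * R := by
    rw [hR, ← prod_union disjoint_sdiff, union_sdiff_of_subset hJ']
  have hzero : ∀ j ∈ J \ J', exPoly (ind (V j ∩ Q j)) * ∏ l ∈ J.erase j, D l = 0 := by
    intro j hj
    rw [hz j (mem_sdiff.1 hj).1 (mem_sdiff.1 hj).2, ind_empty_eq, exPoly_zero, zero_mul]
  have hsum : ∑ j ∈ J, exPoly (ind (V j ∩ Q j)) * ∏ l ∈ J.erase j, D l =
      (∑ j ∈ J', exPoly (ind (V j ∩ Q j)) * ∏ l ∈ J'.erase j, D l) * R := by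
    rw [← sum_sdiff hJ', sum_eq_zero hzero, zero_add, sum_mul]
    exact sum_congr rfl fun j hj => by rw [hsplit j hj, mul_assoc]
  rw [hsum, hfull, ← mul_assoc] at h
  exact mul_right_cancel₀ hRne h

/-- (GI) for a single voter `j`: `E(1_{V_j ∩ Q_j}) = E(1_{V₀}) E(1_{Q_j})`. [this work] -/
theorem GI.single {j : κ} {V₀ : Set (Set ι)} {V Q : κ → Set (Set ι)} (h : GI {j} V₀ V Q) :
    exPoly (ind (V j ∩ Q j)) = exPoly (ind V₀) * exPoly (ind (Q j)) := by
  unfold GI at h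
  simpa using h

/-! ### Substitution of a constant for one variable -/

/-- The substitution `X_x ↦ c` (other variables unchanged), an `ℝ`-algebra endomorphism of `ℝ[X_ι]`. [folklore] -/
def substAt (x : ι) (c : ℝ) : MvPolynomial ι ℝ →ₐ[ℝ] MvPolynomial ι ℝ := aeval (update X x (C c))

omit [Fintype ι] in
/-- `substAt x c (X_x) = c`. [folklore] -/
theorem substAt_X_self (x : ι) (c : ℝ) : substAt x c (X x) = C c := by
  rw [substAt, aeval_X, update_self]

omit [Fintype ι] in
/-- A polynomial without `X_x` is fixed by the substitution. [folklore] -/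
theorem substAt_of_degreeOf_eq_zero (x : ι) (c : ℝ) {P : MvPolynomial ι ℝ} (hP : degreeOf x P = 0) : substAt x c P = P := by
  rw [substAt, aeval_eq_eval₂Hom]
  conv_rhs => rw [← aeval_X_left_apply P, aeval_eq_eval₂Hom]
  refine eval₂Hom_congr' rfl (fun i hi _ => ?_) rfl
  have hix : i ≠ x := fun h => (mem_vars_iff_degreeOf_ne_zero.1 hi) (h ▸ hP)
  exact update_of_ne hix _ _

/-- **`substAt x c (E(h)) = E(h^{x←0}) + c · E(h^{x←1} − h^{x←0})`.** [this work] -/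
theorem substAt_exPoly (x : ι) (c : ℝ) (h : Set ι → ℝ) :
    substAt x c (exPoly h) = exPoly (fsec x false h) + C c * exPoly (dsec x h) := by
  have hds : Ignores x (fsec x true h - fsec x false h) := ignores_dsec x h
  rw [exPoly_eq_fsec x h, map_add, map_mul, substAt_X_self,
    substAt_of_degreeOf_eq_zero x c (degreeOf_exPoly_eq_zero_of_ignores (ignores_fsec x false h)),
    substAt_of_degreeOf_eq_zero x c (degreeOf_exPoly_eq_zero_of_ignores hds)]
  rfl

/-- **`X_x ↦ 0` sends `E(h)` to `E(h^{x←0})`.** [this work] -/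
theorem substAt_zero_exPoly (x : ι) (h : Set ι → ℝ) : substAt x 0 (exPoly h) = exPoly (fsec x false h) := by
  rw [substAt_exPoly, C_0, zero_mul, add_zero]

/-- **`X_x ↦ 1` sends `E(h)` to `E(h^{x←1})`.** [this work] -/
theorem substAt_one_exPoly (x : ι) (h : Set ι → ℝ) : substAt x 1 (exPoly h) = exPoly (fsec x true h) := by
  rw [substAt_exPoly, C_1, one_mul, ← exPoly_add]
  congr 1
  funext ω
  simp [dsec]

/-- `X_x ↦ c` on the expectation polynomial of an `x`-section (which is `x`-free). [this work] -/
theorem substAt_exPoly_ind_secAt (x : ι) (c : ℝ) (b : Bool) (A : Set (Set ι)) :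
    substAt x c (exPoly (ind (secAt x b A))) = exPoly (ind (secAt x b A)) :=
  substAt_of_degreeOf_eq_zero x c (degreeOf_exPoly_eq_zero_of_ignores (SharedCoordinate.ignores_ind_secAt x b A))

/-- **An event frozen to `1` at `x` (`Q^{x←0} = ∅`) has `E(1_Q) = X_x · E(1_{Q^{x←1}})`.** [this work] -/
theorem exPoly_ind_eq_X_mul {x : ι} {A : Set (Set ι)} (hA : secAt x false A = ∅) :
    exPoly (ind A) = X x * exPoly (ind (secAt x true A)) := by
  rw [exPoly_eq_fsec x (ind A), ← ind_secAt, ← ind_secAt, hA, ind_empty_eq, exPoly_zero, zero_add, sub_zero]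

omit [Fintype ι] in
/-- Sub-events of an event frozen to `1` at `x` are frozen to `1` at `x`. [this work] -/
theorem secAt_false_inter_eq_empty {x : ι} {A B : Set (Set ι)} (hB : secAt x false B = ∅) : secAt x false (A ∩ B) = ∅ := by
  rw [secAt_inter, hB, Set.inter_empty]

end RigidityAll

end Summit.CriticalPhenomena.PercolationContinuityZ3.Theorems
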